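import Summits.RiemannHypothesis.RiemannHypothesis.Theorems.ScrewManifestSuperlinearOfJBound
import Summits.RiemannHypothesis.RiemannHypothesis.Theorems.ScrewManifestWeakJBound
import Summits.RiemannHypothesis.RiemannHypothesis.Theorems.ScrewManifestJBoundEquiv
import HarnessLib

/-!
# RH-FREE: the slot `JBound` needs the guard `1 ≤ n` — and the superlinear floor from the GUARDED J-bound

`Manifest.JBound` (`Theorems/ScrewManifestDivisorPair.lean`, sos-theory note 3) quantifies over ALL `n`,
including the degenerate `n = 0` (the `0 × 0` remainder is vacuously strictly diagonally dominant for every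
all-ones weight `wJ`), so as typed it is FALSE for a trivial reason (`not_jBound`), and
`superlinearFloor_of_jBound : JBound → SuperlinearFloor` is vacuous.  The intended statement carries the
guard `1 ≤ n` (as `CornerCostLaw` does); with it the bypass stands:

* `not_jBound : ¬ JBound` (witness `n = 0`, `K = 0`, `wJ = |A| + 1`);
* `superlinearFloor_of_jBound_guarded` : the J-bound for `n ≥ 1` implies `SuperlinearFloor`
  (via `superlinearFloor_of_smallJ`, whose per-height hypothesis is satisfiable at `n = 0` by the empty
  certificate with `wJ = 0`);
* `jBound_guarded_of_plateauBound` : `PlateauBound` implies the J-bound for `n ≥ 1` — the bypass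
  hypothesis is weaker than the plateau slot S2; named form `jBoundGuarded_of_plateauBound :
  PlateauBound → JBoundGuarded` (slot of `ScrewManifestJBoundEquiv`, sos-theory g20).

RH-FREE statements about the certificate FORMAT; nothing here bears on the truth of RH.  References: [folklore].
-/

set_option linter.dupNamespace false
set_option autoImplicit false

noncomputable section

namespace Summit.RiemannHypothesis.RiemannHypothesis.Theorems.IntegerScrew.Manifest

/-- **`JBound` as typed is false** (degenerate `n = 0`: no rows, every `wJ ≥ 0` passes). [folklore] -/
theorem not_jBound : ¬ JBound := by
  intro hJ
  obtain ⟨A, hA⟩ := hJ 1 one_pos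
  have h := hA 0 0 (fun k => Fin.elim0 k) (fun k => Fin.elim0 k) (|A| + 1)
    (fun k => Fin.elim0 k) (by positivity) (fun i => Fin.elim0 i)
  have hA' := le_abs_self A
  norm_num at h
  linarith

/-- **The superlinear floor from the GUARDED J-bound (RH-free):** if for every slope `θ` there is `A` with
`wJ ≤ A/(n+1)` for every strictly-DD manifest certificate of `S_{n+1}`, `n ≥ 1`, at height `θ(n+1)`, then
`SuperlinearFloor`. [folklore] -/
theorem superlinearFloor_of_jBound_guarded
    (hJ : ∀ θ : ℝ, 0 < θ → ∃ A : ℝ, ∀ (n K : ℕ) (t w : Fin K → ℝ) (wJ : ℝ), 1 ≤ n →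
      (∀ k, 0 < t k ∧ t k ≤ θ * (n + 1) ∧ 0 ≤ w k) → 0 ≤ wJ →
        IsStrictDiagDominant (remainder n K t w wJ) → wJ ≤ A / (n + 1)) :
    SuperlinearFloor := by
  refine superlinearFloor_of_smallJ fun θ hθ => ?_
  obtain ⟨A, hA⟩ := hJ θ hθ
  refine ⟨max A 0, fun n tmin _ hcert => ?_⟩
  have hn1 : (0 : ℝ) < (n : ℝ) + 1 := by positivity
  rcases Nat.eq_zero_or_pos n with hn | hn
  · -- `n = 0`: the empty certificate with `wJ = 0`
    subst hn
    refine ⟨0, fun k => Fin.elim0 k, fun k => Fin.elim0 k, 0, fun k => Fin.elim0 k, le_rfl, ?_,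
      fun i => Fin.elim0 i⟩
    exact div_nonneg (le_max_right _ _) hn1.le
  · obtain ⟨K, t, w, wJ, hat, hwJ, hDD⟩ := hcert
    have hat' : ∀ k, 0 < t k ∧ t k ≤ θ * (n + 1) ∧ 0 ≤ w k :=
      fun k => ⟨(hat k).2.2.1, (hat k).2.1, (hat k).2.2.2⟩
    have h1 := hA n K t w wJ hn hat' hwJ hDD
    have h2 : A / ((n : ℝ) + 1) ≤ max A 0 / ((n : ℝ) + 1) :=
      div_le_div_of_nonneg_right (le_max_left _ _) hn1.le
    exact ⟨K, t, w, wJ, hat', hwJ, le_trans h1 h2, hDD⟩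

/-- **S2 implies the guarded S2a (RH-free): `PlateauBound` ⇒ the J-bound for `n ≥ 1`.**  For `n + 1 ≥ 15`
the largest multiple of `12` below `n + 1` is a factor-rich TOP row, where `wJ < (3/2)·R_ii ≤ (3/2)·A/(n+1)`
(`wJ_lt_of_factorRich`); for `1 ≤ n ≤ 13` strict dominance of row `0` (node `2`) gives
`wJ < 2η(log 2) ≤ 2Ψ(log 2)`.  So the bypass hypothesis is WEAKER than the plateau slot. [folklore] -/
theorem jBound_guarded_of_plateauBound (hP : PlateauBound) :
    ∀ θ : ℝ, 0 < θ → ∃ A : ℝ, ∀ (n K : ℕ) (t w : Fin K → ℝ) (wJ : ℝ), 1 ≤ n →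
      (∀ k, 0 < t k ∧ t k ≤ θ * (n + 1) ∧ 0 ≤ w k) → 0 ≤ wJ →
        IsStrictDiagDominant (remainder n K t w wJ) → wJ ≤ A / (n + 1) := by
  intro θ hθ
  obtain ⟨A, hA⟩ := hP θ hθ
  set c : ℝ := 2 * |Literature.NumberTheory.LFunctions.zetaScrew (Real.log 2)| * 15 with hc
  refine ⟨max (3 / 2 * A) c, fun n K t w wJ hn hat hwJ hD => ?_⟩
  have hN0 : (0 : ℝ) < (n : ℝ) + 1 := by positivity
  by_cases hN : 15 ≤ n + 1
  · -- a factor-rich top row `m = 12k`, `k = (n+1)/12`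
    set k : ℕ := (n + 1) / 12 with hk
    have hk1 : 1 ≤ k := by omega
    have hm : 12 * k ≤ n + 1 := by omega
    have hm' : n ≤ 4 * (12 * k) := by omega
    have hi : 12 * k - 2 < n := by omega
    have hrich : FactorRich (((⟨12 * k - 2, hi⟩ : Fin n) : ℕ) + 2) := by
      rw [show ((⟨12 * k - 2, hi⟩ : Fin n) : ℕ) + 2 = 12 * k by simp; omega]
      exact factorRich_twelve_mul k hk1
    have h1 := hA n K t w wJ hat hwJ hD ⟨12 * k - 2, hi⟩ (by show n ≤ 4 * (12 * k - 2 + 2); omega)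
    have h2 := wJ_lt_of_factorRich n K t w wJ hD ⟨12 * k - 2, hi⟩ hrich
    have h3 : 3 / 2 * A / ((n : ℝ) + 1) ≤ max (3 / 2 * A) c / ((n : ℝ) + 1) :=
      div_le_div_of_nonneg_right (le_max_left _ _) hN0.le
    have h4 : 3 / 2 * (A / ((n : ℝ) + 1)) = 3 / 2 * A / ((n : ℝ) + 1) := by ring
    linarith
  · -- `1 ≤ n ≤ 13`: row `0` (node `2`)
    push Not at hN
    have hrow := hD ⟨0, hn⟩
    have hsum : 0 ≤ ∑ j ∈ Finset.univ.erase (⟨0, hn⟩ : Fin n), |remainder n K t w wJ ⟨0, hn⟩ j| :=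
      Finset.sum_nonneg fun _ _ => abs_nonneg _
    have hdiag : remainder n K t w wJ ⟨0, hn⟩ ⟨0, hn⟩
        = 2 * remainderFn K t w (node n ⟨0, hn⟩) - wJ := by
      rw [remainder_apply_remainderFn, sub_self, remainderFn_zero]; ring
    have hnode : node n ⟨0, hn⟩ = Real.log 2 := by simp [node]
    have hη : remainderFn K t w (node n ⟨0, hn⟩)
        ≤ Literature.NumberTheory.LFunctions.zetaScrew (Real.log 2) := by
      rw [hnode]
      exact remainderFn_le_zetaScrew K t w (fun k => (hat k).2.2) _
    have hΨ := le_abs_self (Literature.NumberTheory.LFunctions.zetaScrew (Real.log 2))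
    have hwJc : wJ ≤ c / 15 := by rw [hc]; linarith
    have hN14 : (n : ℝ) + 1 ≤ 15 := by
      have : n + 1 ≤ 15 := by omega
      exact_mod_cast this
    have hc0 : 0 ≤ c := by rw [hc]; positivity
    have h5 : c / 15 ≤ c / ((n : ℝ) + 1) := div_le_div_of_nonneg_left hc0 hN0 hN14
    have h6 : c / ((n : ℝ) + 1) ≤ max (3 / 2 * A) c / ((n : ℝ) + 1) :=
      div_le_div_of_nonneg_right (le_max_right _ _) hN0.le
    linarith

/-- **S2 ⇒ S2a (named slots, RH-free): `PlateauBound → JBoundGuarded`** (`JBoundGuarded` of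
`ScrewManifestJBoundEquiv` is verbatim the guarded hypothesis above). [folklore] -/
theorem jBoundGuarded_of_plateauBound (hP : PlateauBound) : JBoundGuarded :=
  jBound_guarded_of_plateauBound hP

end Summit.RiemannHypothesis.RiemannHypothesis.Theorems.IntegerScrew.Manifest

end
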